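/-
Copyright (c) 2026 the pub-hodgecm-mathlib formalisation cell (harness21).  Prover seat hodgecm-mathlib-K2Liu-p10 (g4), Track B «K2-LIT»,
#184♮ = hLiu418 = `stmt-HodgeConjecture-24832`; (σ) endgame organ, (L3-a): the Levi character of V8e read off the Siegel law.  KERNEL: theorems only.
-/
import Literature.NumberTheory.K2Lit.DoubledUnitaryDegeneratePrincipalSeries          -- ★ `localDegPS`, `localSiegelCharacter`, `IsSiegelDelta`
import Literature.RepresentationTheory.HeisenbergGroup.SchrodingerSymplecticGenerators   -- ★ `leviEquivSB`, `SchwartzBruhat`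
import HarnessLib

/-!
# Crux `HLiu418`, (σ) endgame, (L3-a): THE LEVI CHARACTER `c_M` OF V8e IS THE SIEGEL CHARACTER `χ_v(det_Δ)|det_Δ|^{s+n/2}` — read off the section's Siegel law

Cell `hodgecm-mathlib`, crux item hLiu418 = `stmt-HodgeConjecture-24832`, route of record `HCCMUnconditional`; squad K2 ∕ K2Liu, prover K2Liu-p10 (g4).
THEOREMS ONLY; lane `--supports stmt-HodgeConjecture-24832 --as helper`.  V8e currency (★ `K2LiuA7ValueFaceTwo.face_two_of_laws`): `ω`, `𝒜 : 𝒮(X) →ₗ I_v(s, χ_v)` with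
`h𝒜` (equivariance), the Levi pins `mΔ : Γ₁ →* H_v` (Siegel), `aX`, `cM` with `hM : ω (mΔ a) Φ = cM a • leviEquivSB (aX a) Φ`.

**`coe_cM_eq_localSiegelCharacter`**: under ONE extra instance letter `h𝒜1 : (𝒜 Ψ) 1 = κ · Ψ 0` (`κ ≠ 0`; at the instance `𝒜 = sectionMap (swSectionDelta … sΔB)`,
`f_Ψ(1) = (ω(1)Ψ)(0)`) and `𝒮(X) ∋ Φ` with `Φ 0 ≠ 0`, the Levi character is FORCED: **`cM a = localSiegelCharacter χv s (mΔ a)` for every `a ∈ Γ₁`** — compute `(𝒜 Φ)(mΔ a)`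
once by the Siegel law of `𝒜 Φ ∈ I_v(s, χ_v)` and once by `h𝒜` + `hM` (`leviEquivSB a Φ = Φ ∘ a⁻¹` fixes the value at `0`).  Hence V8e's `hK₁χ` on `K₁` REDUCES to the
character comparison `localSiegelCharacter χv s = localSiegelCharacter χv′ s′` on `mΔ(K₁)` (**`hK₁χ_of_shift`**; the comparison itself = (L3-b)), and `ha₀` to its failure at `a₀`
(**`ha₀_of_shift_ne`**).

HONEST LABEL: HC_CM is proved only modulo the 7 printed citations (2 remaining named inputs: hLiu418 = stmt-HodgeConjecture-24832, h413 = stmt-HodgeConjecture-24833)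
until rung 0 closes; helper, closes no item.
References: [Kudla1994] S. Kudla, Israel J. Math. 87 (1994) §3 Thm. 3.1 (the Siegel eigen-law of `Φ ↦ ω(h)Φ(0)`); [HarrisKudlaSweet1996] §1 (1.15)–(1.16);
[Weil1964] n° 13 (the Levi operators).
-/

set_option autoImplicit false
set_option linter.dupNamespace false -- the mandated namespace repeats `HodgeConjecture.HodgeConjecture`

noncomputable section

open scoped Matrix
open NumberField IsDedekindDomain
open Literature.NumberTheory.Automorphic Literature.NumberTheory.Automorphic.UnitaryGroup
open Literature.NumberTheory.GelbartRogawski1991.UnitaryDualPair.LocalSplitting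
open Literature.NumberTheory.K2Lit.LocalSiegelDoubled
open Literature.RepresentationTheory.HeisenbergGroup

namespace Summit.HodgeConjecture.HodgeConjecture.Cruxes.HLiu418.K2LiuLeviCharacterFromSiegelLaw

variable (F : Type) [Field F] [NumberField F] (E : Type) [Field E] [NumberField E] [Algebra F E]
  [Algebra.IsQuadraticExtension F E] (c : E ≃ₐ[F] E)
  {δ : E} (hcδ : c δ = -δ) (hδ : δ ≠ 0) {d : F} (hd : δ * δ = algebraMap F E d) (v : HeightOneSpectrum (𝓞 F)) (n : ℕ)
  {T₀ : Matrix (Fin n) (Fin n) F} (hT₀ : T₀.IsSymm)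
  {JD : Matrix (Fin (n + n)) (Fin (n + n)) E} (hJD : JD = (gramD F n T₀).map (algebraMap F E))
  (χv : ∀ w : PlacesOver E v, (w.1.adicCompletion E)ˣ →* ℂˣ) (s : ℂ)
  {ιX : Type}
  (ω : UnitaryGroup.localPi E c (n + n) JD v → SchwartzBruhat (ιX → v.adicCompletion F) →ₗ[ℂ] SchwartzBruhat (ιX → v.adicCompletion F))
  (𝒜 : SchwartzBruhat (ιX → v.adicCompletion F) →ₗ[ℂ] ↥(localDegPS F E c hcδ hδ hd v n hT₀ hJD χv s))
  (h𝒜 : ∀ (u : UnitaryGroup.localPi E c (n + n) JD v) (Φ : SchwartzBruhat (ιX → v.adicCompletion F)) (x : UnitaryGroup.localPi E c (n + n) JD v),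
    ((𝒜 (ω u Φ) : ↥(localDegPS F E c hcδ hδ hd v n hT₀ hJD χv s)) : UnitaryGroup.localPi E c (n + n) JD v → ℂ) x =
      ((𝒜 Φ : ↥(localDegPS F E c hcδ hδ hd v n hT₀ hJD χv s)) : UnitaryGroup.localPi E c (n + n) JD v → ℂ) (x * u))
  {κ : ℂ} (hκ : κ ≠ 0)
  (h𝒜1 : ∀ Ψ : SchwartzBruhat (ιX → v.adicCompletion F),
    ((𝒜 Ψ : ↥(localDegPS F E c hcδ hδ hd v n hT₀ hJD χv s)) : UnitaryGroup.localPi E c (n + n) JD v → ℂ) 1 = κ * (Ψ : (ιX → v.adicCompletion F) → ℂ) 0)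
  (hΦ : ∃ Φ : SchwartzBruhat (ιX → v.adicCompletion F), (Φ : (ιX → v.adicCompletion F) → ℂ) 0 ≠ 0)
  {Γ₁ : Type} [Group Γ₁]
  (mΔ : Γ₁ →* UnitaryGroup.localPi E c (n + n) JD v) (hmΔ : ∀ a, IsSiegelDelta F E c hcδ hδ hd v n hT₀ hJD (mΔ a))
  (aX : Γ₁ →* ((ιX → v.adicCompletion F) ≃ₗ[v.adicCompletion F] (ιX → v.adicCompletion F)))
  (haXc : ∀ a, Continuous (aX a)) (haXc' : ∀ a, Continuous (aX a).symm)
  (cM : Γ₁ →* ℂˣ)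
  (hM : ∀ (a : Γ₁) (Φ : SchwartzBruhat (ιX → v.adicCompletion F)), ω (mΔ a) Φ = (cM a : ℂ) • leviEquivSB (aX a) (haXc a) (haXc' a) Φ)

include h𝒜 hκ h𝒜1 hΦ hmΔ hM

/-- **THE LEVI CHARACTER IS THE SIEGEL CHARACTER**: `cM a = χ_v(det_Δ m(a))·|det_Δ m(a)|^{s + n/2}` for every `a ∈ Γ₁`. [cite: Kudla1994, §3 Thm. 3.1]
[cite: HarrisKudlaSweet1996, §1 (1.15)] -/
theorem coe_cM_eq_localSiegelCharacter (a : Γ₁) : (cM a : ℂ) = localSiegelCharacter F E c v n χv s (mΔ a) := by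
  obtain ⟨Φ, hΦ0⟩ := hΦ
  -- `(𝒜 Φ)(mΔ a)` by the Siegel law of the section `𝒜 Φ ∈ I_v(s, χ_v)`
  have hsec := ((𝒜 Φ).2).1 (mΔ a) (hmΔ a) 1
  rw [mul_one, h𝒜1] at hsec
  -- `(𝒜 Φ)(mΔ a)` by equivariance and the Levi law
  have hequi := h𝒜 (mΔ a) Φ 1
  rw [one_mul, hM, map_smul, Submodule.coe_smul, Pi.smul_apply, smul_eq_mul, h𝒜1, coe_leviEquivSB, leviOp_apply, map_zero] at hequi
  -- compare
  have hne : κ * (Φ : (ιX → v.adicCompletion F) → ℂ) 0 ≠ 0 := mul_ne_zero hκ hΦ0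
  have h := hequi.trans hsec
  -- `cM a * (κ Φ0) = char * (κ Φ0)`
  exact mul_right_cancel₀ hne h

/-- **V8e's `hK₁χ` REDUCED TO A CHARACTER COMPARISON**: if on `K₁` the two Siegel characters agree on `mΔ(K₁)`, then `cM = localSiegelCharacter χv′ s′ ∘ mΔ` on `K₁`.
[cite: HarrisKudlaSweet1996, §1 (1.15)] -/
theorem hK₁χ_of_shift (χv' : ∀ w : PlacesOver E v, (w.1.adicCompletion E)ˣ →* ℂˣ) (s' : ℂ) (K₁ : Subgroup Γ₁)
    (hshift : ∀ a ∈ K₁, localSiegelCharacter F E c v n χv s (mΔ a) = localSiegelCharacter F E c v n χv' s' (mΔ a)) :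
    ∀ a ∈ K₁, (cM a : ℂ) = localSiegelCharacter F E c v n χv' s' (mΔ a) := fun a ha => by
  rw [coe_cM_eq_localSiegelCharacter F E c hcδ hδ hd v n hT₀ hJD χv s ω 𝒜 h𝒜 hκ h𝒜1 hΦ mΔ hmΔ aX haXc haXc' cM hM a, hshift a ha]

/-- **V8e's `ha₀`** from an element where the two Siegel characters differ. [cite: HarrisKudlaSweet1996, §1 (1.15)] -/
theorem ha₀_of_shift_ne (χv' : ∀ w : PlacesOver E v, (w.1.adicCompletion E)ˣ →* ℂˣ) (s' : ℂ) (a₀ : Γ₁)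
    (hne : localSiegelCharacter F E c v n χv s (mΔ a₀) ≠ localSiegelCharacter F E c v n χv' s' (mΔ a₀)) :
    (cM a₀ : ℂ) ≠ localSiegelCharacter F E c v n χv' s' (mΔ a₀) := by
  rw [coe_cM_eq_localSiegelCharacter F E c hcδ hδ hd v n hT₀ hJD χv s ω 𝒜 h𝒜 hκ h𝒜1 hΦ mΔ hmΔ aX haXc haXc' cM hM a₀]
  exact hne

end Summit.HodgeConjecture.HodgeConjecture.Cruxes.HLiu418.K2LiuLeviCharacterFromSiegelLaw

end
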